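import Summits.BirchSwinnertonDyer.Rank1Residual.F1Sign2.UnitLocusAtTwo
import Literature.NumberTheory.EllipticCurves.QuadraticTwist
import Literature.NumberTheory.EllipticCurves.Rank1Residual.Typed.Basic
import HarnessLib

/-!
# Cell `bsd-f1-sign2` (`p = 2`, non-CM) — candidate ES-C-D `TwistByTwoOfUnitAtTwo`: on the non-CM unit
# locus at a good supersingular `2`, the `χ₈`-twist `E^{(2)}` has analytic and Mordell–Weil rank `1`,
# `2 ∤ Tam(E^{(2)})`, `Ш(E^{(2)})[2^∞] = 0` and `BSD₂(E^{(2)})` — the FIRST LAYER `ℚ₁ = ℚ(√2)` of the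
# `ℤ₂`-tower read on the twist (Euler-system lens, seat `-es`)

HONEST FRAMING (typer seat `bsd-f1-sign2-ty`; HOME `run/shared/lean/pub/bsd-f1-sign2/`, CANDIDATES.md §2
row ES-C-D): STATEMENT ONLY — one `@[conjecture] def` (OPEN obligation, ours; NOT a published theorem),
re-filed VERBATIM from `HOME/data-es/Sketch.lean` bcb79e6976fcc0bd; nothing asserted, nothing booked, no
named fact, PARTITION: none moved (note: `E^{(2)}` is ADDITIVE at `2`, `N' = 64N`, RANK ONE — its `BSD₂`
is outside every registered `p = 2` line; this is where the novelty sits, REF1). REFUTER PASS: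
REF1-AUDIT-v1.md §1 — **SURVIVES (data-hard)**: a parity kill would need a unit curve with `N ≡ ±1 (8)`
(`w(E^{(2)}) = χ₈(N)·w(E)`) — 0/821 unit curves with `N < 10⁴`, and the tree EXPLAINS it (`λ♭ = 0` ⇒
`even_lam_flat_two_iff` ⇒ `N ≡ ±3 (8)`); mutations noted by refuter-1: `¬ W.HasCM` possibly unnecessary
(30/30 CM unit curves obey), `W'.mordellWeilRank = 1` redundant given `analyticRank = 1 ∧ BSDp W' 2`
(both kept verbatim — the planner's statement). BC7 CLEAN. REF2: pending at filing.

BC5 WITNESS (MEMO-es §3 T4, non-circular: the twist's rank, Tamagawa product and `Ш_an` are computed from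
`E^{(2)}`, not from `E`'s modular symbol): for each non-CM unit row of `HOME/data-es/TABLE-ES-UNIT-v1.tsv`
2a816f914e1323f9 the twist `E^{(2)}` (conductor `64N ≤ 255 680`, located in Cremona `allbsd` by
`(c₄,c₆) ↦ (4u⁴c₄, 8u⁶c₆)`): `rank = 1`, `#tors = 1`, `2 ∤ ∏c_ℓ`, `Ш_an = 1` on **263/263** (`a₂ = 0`:
109, `2`: 106, `−2`: 48); refuter-1's independent scan: **630/630** non-CM unit curves with `N < 7813`;
the same law FAILS on 341/355 non-unit rank-`0` rows (a discriminator, not a tautology). CHEAPEST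
FALSIFIER: one unit row whose twist breaks any conjunct (0/263, 0/630). WHY NOVEL (MEMO-es §3):
Kurihara–Otsuki 2006 Thm. 0.1(2) gives `Sel(E/ℚ₁) ≅ ℚ₂/ℤ₂` over `ℚ₁ = ℚ(√2)` for `a₂ = ±2`; the twist
reading with exact rank, Tamagawa parity, `Ш[2^∞] = 0` and `BSD₂` of the additive rank-`1` twist is not
in print for any trace.

References: [KuriharaOtsuki2006] Thm. 0.1 (2); HOME MEMO-es.md §3; REF1-AUDIT-v1.md §1;
[cite: Miller2011LMS, Def. 1.1] (`BSD(E,p)`).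
-/

set_option autoImplicit false

noncomputable section

open scoped Classical

open WeierstrassCurve Literature.NumberTheory.EllipticCurves
  Literature.NumberTheory.EllipticCurves.Rank1Residual
  Literature.NumberTheory.EllipticCurves.Rank1Residual.Typed

namespace Summit.BirchSwinnertonDyer.Rank1Residual.F1Sign2

/-- **CANDIDATE ES-C-D `TwistByTwoOfUnitAtTwo` (OPEN; cell `bsd-f1-sign2`, lens `-es`).** For non-CM
`E/ℚ` (globally minimal) with good reduction at `2`, `2 ∣ a₂`, `ord₂(L(E,1)/Ω_E) = 0` and `2 ∤ Tam(E)`: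
every globally minimal model `W'` of the quadratic twist `E^{(2)}` (`∃ C, C • W.quadraticTwist 2 = W'`)
has analytic rank `1`, Mordell–Weil rank `1`, `2 ∤ Tam(W')`, `Ш(W')[2^∞]` finite of order `1`, and
`BSD(W', 2)` (Kurihara–Otsuki's `Sel(E/ℚ₁) ≅ ℚ₂/ℤ₂` over `ℚ₁ = ℚ(√2)` read on the `χ₈`-twist). REF1:
SURVIVES (data-hard; `¬HasCM` possibly unnecessary, the MW-rank conjunct redundant — kept verbatim).
Witness: 263/263 (-es) and 630/630 (refuter-1) non-CM unit curves.
[cite: KuriharaOtsuki2006, Thm. 0.1 (2) (`Sel(E/ℚ_n) ≃ ℚ₂/ℤ₂` for `n = 1`, the printed shadow; the statement is NOT in print)] -/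
@[conjecture] def TwistByTwoOfUnitAtTwo : Prop :=
  ∀ (W : WeierstrassCurve ℚ) [W.IsElliptic] [W.IsGloballyMinimal],
    W.HasGoodReductionAtPrime 2 → (2 : ℤ) ∣ W.frobeniusTrace 2 → ¬ W.HasCM → UnitLValueAtTwo W →
    ¬ 2 ∣ W.tamagawaProduct →
    ∀ (W' : WeierstrassCurve ℚ) [W'.IsElliptic] [W'.IsGloballyMinimal],
      (∃ C : VariableChange ℚ, C • W.quadraticTwist 2 = W') →
      W'.analyticRank = 1 ∧ W'.mordellWeilRank = 1 ∧ ¬ 2 ∣ W'.tamagawaProduct ∧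
        Finite (AddCommGroup.primaryComponent W'.sha 2) ∧
        Nat.card (AddCommGroup.primaryComponent W'.sha 2) = 1 ∧ BSDp W' 2

end Summit.BirchSwinnertonDyer.Rank1Residual.F1Sign2

end
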